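/-
Copyright (c) 2026 the pub-hodgecm-mathlib formalisation cell (harness21).  Prover seat hodgecm-mathlib-K2Liu-p01 (g9), Track B «K2-LIT»,
#184♮ = hLiu418 = `stmt-HodgeConjecture-24832`; #42S organ S1 ROAD W, inert witness TOP FILE part (ii) (RECIPE-F7-InertWitnessTopFile 80571dd96a2cf31d §B,
SPEC-F7-FrameStep §1): THE HYPERBOLIC FRAME `P` OF A TERNARY DIAGONAL HERMITIAN FORM AT AN INERT UNRAMIFIED NON-DYADIC PLACE — the `P ∕ hPdet ∕ hP ∕ d_K` letters of
★ κ-comp `exists_frame_homeomorph` (`d_K = −d₀d₁d₂`).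
-/
import Summits.HodgeConjecture.HodgeConjecture.Theorems.K2LiuHyperbolicFrameOfIsotropic     -- ★ (K2Liu-p10) `exists_hyperbolic_frame_of_isotropic`; ★ (ii-a) `exists_pair_even_sub`, `herm_pair_pair`
import Summits.HodgeConjecture.HodgeConjecture.Theorems.K2LiuInertWitnessDuality           -- ★ (W2-b) `exists_integral_conj_sub_unit`, ★ `conjLocal_apply_of_smul_eq`
import Literature.NumberTheory.Automorphic.UnitaryThreeAnisotropicNormalForm               -- ★ `exists_mul_map_eq_of_v_eq_exp_even` (σ-fixed elements of even valuation are norms)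
import Literature.NumberTheory.Automorphic.HyperspecialUnitaryCartanAdicCompletion         -- ★ `localConjDatum_adicCompletion`
import Literature.NumberTheory.Automorphic.AdicCompletionIntegersAdicComplete              -- ★ `isAdicComplete_valuedMaximalIdeal_valuedInteger_adicCompletion`
import Literature.NumberTheory.Automorphic.AdicCompletionCompact                           -- ★ `finite_residueField_adicCompletion`
import Literature.NumberTheory.Automorphic.SymplecticGroupCartanUnique                     -- ★ `CartanUnique.isDiscreteValuationRing_integer`
import HarnessLib

/-!
# Crux `HLiu418`, #42S-S1 ROAD W, (ii): THE HYPERBOLIC FRAME OF `diag(d₀, d₁, d₂)` OVER `E_{w₀}` AT AN INERT UNRAMIFIED NON-DYADIC PLACE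

Cell `hodgecm-mathlib`, crux item hLiu418 = `stmt-HodgeConjecture-24832` (helper lane `--supports … --as helper`, count-neutral).  THEOREMS ONLY (no `def`, no instance,
no notation, no named-fact hypothesis, no `sorry`).  Generic quadratic extension `E/F` with `c`, inert unramified non-dyadic `w₀ ∣ v` (`hc hw₀ hv h2`), `K = E_{w₀}`,
`σ = σ_{w₀} = galAdicCompletionMap c hw₀`.

THE STATEMENT (`exists_inert_hyperbolic_frame`): for `d : Fin 3 → K` with `σ d_k = d_k ≠ 0` (the frame `dV′` of `V′` read at `w₀`), there is `P ∈ M₃(K)` with `det P = 1` and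
`P · diag(d)ᵀ · σ(P)ᵀ = [[0,1,0],[1,0,0],[0,0,−d₀d₁d₂]]` — EXACTLY the `(hPdet, hP)` letters of ★ κ-comp `K2LiuWitnessFrameCoordinateContinuous.exists_frame_homeomorph` with
`D := diagonal d`, `d_K := −d₀d₁d₂` (so the (g2) phase of the witness is `v_{w₀}(d₀d₁d₂) mod 2`).
PROOF.  Two of the three valuations `v(d_k) ∈ ℤ` have the same parity (★ (ii-a) `exists_pair_even_sub`), so `c = −d_j∕d_i` is `σ`-fixed of EVEN valuation, hence a norm
`λ·σλ` in the unramified `K∕F_v` (★ `exists_mul_map_eq_of_v_eq_exp_even`, local conjugation datum ★ `localConjDatum_adicCompletion` at `v ∤ 2`, the residue-class mover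
★ (W2-b) `exists_integral_conj_sub_unit`); `u = λe_i + e_j ≠ 0` is ISOTROPIC (★ (ii-a) `herm_pair_pair`), `t₀ = ½` has `t₀ + σt₀ = 1`, and ★ (K2Liu-p10) `exists_hyperbolic_frame_of_isotropic`
gives the frame.  [Scharlau1985HermitianForms, Ch. 7 §6] [Serre1979, Ch. V §2 Prop. 3] [Jacobowitz1962, §7] [Shimura1997, §13.2].
HONEST LABEL.  Count-neutral helper; `HC_CM` is proved only modulo the 7 printed citations (2 remaining named inputs: hLiu418 = `stmt-HodgeConjecture-24832`,
h413 = `stmt-HodgeConjecture-24833`) until rung 0 closes.  NOT here: the coordinate iso `κ` (★ κ-comp + (K-tot)), the reading of `dV′` at `w₀`.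

## References
* [Scharlau1985HermitianForms] W. Scharlau, *Quadratic and Hermitian Forms*, Grundlehren 270 (1985), Ch. 7 §6.
* [Serre1979] J.-P. Serre, *Local Fields*, GTM 67 (1979), Ch. V §2 Prop. 3.
* [Jacobowitz1962] R. Jacobowitz, Amer. J. Math. 84 (1962), §7.
* [Shimura1997] G. Shimura, *Euler Products and Eisenstein Series*, CBMS 93 (1997), §13.2.
-/

set_option autoImplicit false
set_option linter.dupNamespace false -- the mandated namespace repeats `HodgeConjecture.HodgeConjecture`

noncomputable section

open Matrix IsLocalRing NumberField IsDedekindDomain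
open scoped Valued WithZero
open Literature.NumberTheory.Automorphic Literature.NumberTheory.Automorphic.UnitaryGroup Literature.NumberTheory.Automorphic.HermitianLattice

namespace Summit.HodgeConjecture.HodgeConjecture.Cruxes.HLiu418.K2LiuInertHyperbolicFrame

open K2LiuHyperbolicPairOfIsotropicNorm K2LiuHyperbolicFrameOfIsotropic K2LiuLocalRingInertReading K2LiuInertWitnessDuality

variable {F E : Type} [Field F] [NumberField F] [Field E] [NumberField E] [Algebra F E] [Algebra.IsQuadraticExtension F E]
  (c : E ≃ₐ[F] E) {v : HeightOneSpectrum (𝓞 F)} (w₀ : PlacesOver E v)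

omit [NumberField F] [Algebra.IsQuadraticExtension F E] in
/-- a non-zero element of `K = E_{w₀}` has an integer valuation: `v(x) = exp(log v(x))`. [folklore] -/
theorem valued_eq_exp_log {x : w₀.1.adicCompletion E} (hx : x ≠ 0) : Valued.v x = WithZero.exp (WithZero.log (Valued.v x)) :=
  (WithZero.exp_log ((Valuation.ne_zero_iff _).2 hx)).symm

/-- **THE HYPERBOLIC FRAME AT AN INERT UNRAMIFIED NON-DYADIC PLACE**: for `σ`-fixed non-zero `d₀, d₁, d₂ ∈ E_{w₀}` there is `P` with `det P = 1` and
`P·diag(d)ᵀ·σ(P)ᵀ = [[0,1,0],[1,0,0],[0,0,−d₀d₁d₂]]`. [cite: Scharlau1985HermitianForms, Ch. 7 §6] [cite: Serre1979, Ch. V §2 Prop. 3] [cite: Jacobowitz1962, §7] -/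
theorem exists_inert_hyperbolic_frame (hc : c ≠ 1) (hw₀ : c • w₀.1 = w₀.1) (hv : Algebra.IsUnramifiedIn (𝓞 E) v.asIdeal) (h2 : (2 : 𝓞 F) ∉ v.asIdeal)
    (d : Fin 3 → w₀.1.adicCompletion E) (hσd : ∀ k, galAdicCompletionMap (L := E) c hw₀ (d k) = d k) (hd0 : ∀ k, d k ≠ 0) :
    ∃ P : Matrix (Fin 3) (Fin 3) (w₀.1.adicCompletion E), P.det = 1 ∧
      P * (Matrix.diagonal d)ᵀ * (P.map (galAdicCompletionMap (L := E) c hw₀))ᵀ = !![0, 1, 0; 1, 0, 0; 0, 0, -(d 0 * d 1 * d 2)] := by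
  obtain ⟨ϖ, hdat⟩ := localConjDatum_adicCompletion c hc v w₀ hw₀ hv h2
  haveI : IsDiscreteValuationRing 𝒪[w₀.1.adicCompletion E] := CartanUnique.isDiscreteValuationRing_integer hdat.vϖ
  haveI : Finite 𝓀[w₀.1.adicCompletion E] := finite_residueField_adicCompletion E w₀.1
  haveI : IsAdicComplete 𝓂[w₀.1.adicCompletion E] 𝒪[w₀.1.adicCompletion E] := isAdicComplete_valuedMaximalIdeal_valuedInteger_adicCompletion E w₀.1
  -- `σ` preserves `𝒪 = 𝒪[K]` (it is isometric); the residue-class mover `a₀` (★ (W2-b) §6)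
  have hσO : ∀ y : 𝒪[w₀.1.adicCompletion E],
      ((galAdicCompletionMap (L := E) c hw₀).comp (𝒪[w₀.1.adicCompletion E]).subtype) y ∈ 𝒪[w₀.1.adicCompletion E] := fun y => by
    change Valued.v (galAdicCompletionMap (L := E) c hw₀ (y : w₀.1.adicCompletion E)) ≤ 1
    rw [valued_galAdicCompletionMap]
    exact y.2
  obtain ⟨α, hαint, hα⟩ := exists_integral_conj_sub_unit F E c v hc w₀ hw₀ hv
  have hαmem : α w₀ ∈ 𝒪[w₀.1.adicCompletion E] := by
    change Valued.v (α w₀) ≤ 1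
    exact hαint w₀
  have ha₀ : IsUnit ((((galAdicCompletionMap (L := E) c hw₀).comp (𝒪[w₀.1.adicCompletion E]).subtype).codRestrict 𝒪[w₀.1.adicCompletion E] hσO)
      ⟨α w₀, hαmem⟩ - ⟨α w₀, hαmem⟩) := by
    refine (Valuation.integer.integers (Valued.v (R := w₀.1.adicCompletion E))).isUnit_iff_valuation_eq_one.2 ?_
    change Valued.v (galAdicCompletionMap (L := E) c hw₀ (α w₀) - α w₀) = 1
    rw [← conjLocal_apply_of_smul_eq c hc v w₀ hw₀, ← Pi.sub_apply]
    exact hα w₀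
  -- two of the three valuations have the same parity
  have hvne : ∀ k, Valued.v (d k) ≠ 0 := fun k => (Valuation.ne_zero_iff _).2 (hd0 k)
  obtain ⟨i, j, hij, r, hr⟩ := exists_pair_even_sub fun k => WithZero.log (Valued.v (d k))
  -- `c = −d_j∕d_i` is `σ`-fixed of valuation `exp(2·(−r))`, hence a norm `λ·σλ`
  have hvc : Valued.v (-(d j / d i)) = WithZero.exp (2 * (-r)) := by
    rw [Valuation.map_neg, map_div₀, valued_eq_exp_log w₀ (hd0 j), valued_eq_exp_log w₀ (hd0 i), ← WithZero.exp_sub]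
    congr 1
    omega
  have hσc : galAdicCompletionMap (L := E) c hw₀ (-(d j / d i)) = -(d j / d i) := by rw [map_neg, map_div₀, hσd, hσd]
  obtain ⟨lam, hlam⟩ := exists_mul_map_eq_of_v_eq_exp_even (galAdicCompletionMap (L := E) c hw₀) hdat hσO ha₀ hσc hvc
  -- the isotropic vector `u = λ e_i + e_j`
  have huu : (∑ k, d k * ((Pi.single i lam : Fin 3 → w₀.1.adicCompletion E) + (Pi.single j 1 : Fin 3 → w₀.1.adicCompletion E)) k *
      galAdicCompletionMap (L := E) c hw₀
        (((Pi.single i lam : Fin 3 → w₀.1.adicCompletion E) + (Pi.single j 1 : Fin 3 → w₀.1.adicCompletion E)) k)) = 0 := by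
    rw [herm_pair_pair (galAdicCompletionMap (L := E) c hw₀) d hij lam 1 lam 1, map_one, mul_one, mul_one, mul_assoc, hlam, mul_neg, mul_div_cancel₀ _ (hd0 i),
      neg_add_cancel]
  have hu0 : ((Pi.single i lam : Fin 3 → w₀.1.adicCompletion E) + (Pi.single j 1 : Fin 3 → w₀.1.adicCompletion E)) ≠ 0 := by
    intro h
    have hj := congrFun h j
    rw [Pi.add_apply, Pi.single_eq_of_ne hij.symm, Pi.single_eq_same, zero_add, Pi.zero_apply] at hj
    exact one_ne_zero hj
  -- `t₀ = ½`
  have h20 : (2 : w₀.1.adicCompletion E) ≠ 0 := fun h => by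
    have h1 := hdat.v2
    rw [h, map_zero] at h1
    exact zero_ne_one h1
  have ht₀ : (2 : w₀.1.adicCompletion E)⁻¹ + galAdicCompletionMap (L := E) c hw₀ (2 : w₀.1.adicCompletion E)⁻¹ = 1 := by
    rw [map_inv₀, map_ofNat, ← two_mul, mul_inv_cancel₀ h20]
  exact exists_hyperbolic_frame_of_isotropic (galAdicCompletionMap (L := E) c hw₀) d hdat.σσ hσd hd0 ht₀ hu0 huu

end Summit.HodgeConjecture.HodgeConjecture.Cruxes.HLiu418.K2LiuInertHyperbolicFrame

end
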